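import Mathlib
import Literature.Computability.AlgebraicComplexity.StandardFamilies
import Summits.ValiantsHypothesis.ValiantsHypothesis.Theses.ElementaryWordLength
import Summits.ValiantsHypothesis.ValiantsHypothesis.Theorems.ElementaryWordLengthVpWordQpWords
import Summits.ValiantsHypothesis.ValiantsHypothesis.Theorems.ElementaryWordLengthWordLengthQPStubTransfer
import Summits.ValiantsHypothesis.ValiantsHypothesis.Theorems.ElementaryWordLengthWordLengthQPStubTruncate
import Summits.ValiantsHypothesis.ValiantsHypothesis.Theorems.ElementaryWordLengthWordLengthQPStubInterpNodes
import Summits.ValiantsHypothesis.ValiantsHypothesis.Theorems.ElementaryWordLengthWordLengthQPStubEvalSum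
import Summits.ValiantsHypothesis.ValiantsHypothesis.Theorems.ElementaryWordLengthWordLengthQPStubProdWord
import Summits.ValiantsHypothesis.ValiantsHypothesis.Theorems.ElementaryWordLengthWordLengthQPStubArith

/-!
# Crux `WordLengthQP` (stmt-ValiantsHypothesis-6623), line `Sketch` (eps-order-ladder) —
the open rung is crux-EQUIVALENT: `EpsOrderLadder ↔ WordLengthQP`

The line `Sketch` reduces the crux `X = WordLengthQP` (no quasi-polynomial affine elementary words
for `E₀₂(per_n)` in `E₃(ℂ[x])`) to the *ε-order ladder* `EpsOrderLadder` (for every `c` some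
`per_n` admits no border width-2 program over `ℂ[ε][x]` with S-affine letters, `ε`-order `q` and
length `L` both `≤ 2^((log₂ n + c)^c)`); the transfer `EpsOrderLadder → X` is the landed theorem
`stub_transfer` (Bringmann–Ikenmeyer–Zuiddam 2018 §3 at quasi-polynomial scale).

This file proves the CONVERSE `X → EpsOrderLadder` (`ladder_of_wordLengthQP`) and records the
equivalence (`ladder_iff_wordLengthQP`), so that the one remaining stub of the line, `stub_ladder`,
is certified to be exactly crux-sized.  De-bordering by truncation and interpolation: a border
program with `(0,0)` entry `ε^q · per_n + ε^(q+1) · G` keeps that shape after every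
`ℂ[ε]`-coefficient of its letters is reduced modulo `ε^(q+1)` (`stub_truncate`); the entry then has
`ε`-degree `≤ L q`, and with moment weights `Σᵢ cᵢ xᵢ^k = [k = q]`, `k ≤ L q + q`
(`stub_interpNodes`, Lagrange) one gets `per_n = Σᵢ cᵢ · F(xᵢ)` where `F(xᵢ)` is the `(0,0)` entry
of the product of the letters evaluated at `ε = xᵢ` (`stub_evalSum`) — an exact width-2 product of
`≤ L` S-affine matrices over `ℂ[x]`, hence a word of length `≤ 2 · 8^E` at every off-diagonal
position by divide and conquer through the Ben-Or–Cleve word algebra (`stub_prodWord`); summing the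
`≤ L q + q + 1` terms gives words of length `≤ 2^((log₂ n + c')^c')` (`stub_arith`) for every `n`,
contradicting `X`.  [folklore de-bordering: Bini 1980 / Bürgisser–Clausen–Shokrollahi 1997 §15.4
(order of approximation and interpolation), here for width-2 S-affine programs.]
-/

-- `Summit.ValiantsHypothesis.ValiantsHypothesis.…` is the tree's mandated single-conjunct layout
-- (Sub = Summit), so the duplicated namespace component is intended.
set_option linter.dupNamespace false

noncomputable section

open MvPolynomial

namespace Summit.ValiantsHypothesis.ValiantsHypothesis.Cruxes.WordLengthQP.EpsOrderLadder

open Literature.Computability.AlgebraicComplexity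
open Summit.ValiantsHypothesis.ValiantsHypothesis.Theorems.VpWordQp

/-- Evaluating `ε ↦ x` maps an S-affine letter over `ℂ[ε][x̄]` to an S-affine letter over
`ℂ[x̄]`. [folklore] -/
theorem sAffine_eval {σ : Type} (x : ℂ) (q : ℕ)
    (m : Matrix (Fin 2) (Fin 2) (MvPolynomial σ (Polynomial ℂ)))
    (hm : ∀ i j : Fin 2, (∃ b : Polynomial ℂ, b.natDegree ≤ q ∧ m i j = MvPolynomial.C b) ∨
      (∃ (a b : Polynomial ℂ) (v : σ), a.natDegree ≤ q ∧ b.natDegree ≤ q ∧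
        m i j = MvPolynomial.C a * MvPolynomial.X v + MvPolynomial.C b)) :
    ∀ i j : Fin 2,
      (∃ b : ℂ, (MvPolynomial.map (Polynomial.evalRingHom x)).mapMatrix m i j = MvPolynomial.C b) ∨
      (∃ (a b : ℂ) (v : σ), (MvPolynomial.map (Polynomial.evalRingHom x)).mapMatrix m i j =
        MvPolynomial.C a * MvPolynomial.X v + MvPolynomial.C b) := by
  intro i j
  rcases hm i j with ⟨b, -, hb⟩ | ⟨a, b, v, -, -, hab⟩
  · exact Or.inl ⟨b.eval x, by simp [RingHom.mapMatrix_apply, hb, map_C]⟩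
  · exact Or.inr ⟨a.eval x, b.eval x, v, by simp [RingHom.mapMatrix_apply, hab, map_C, map_X]⟩

/-- **The converse transfer** `X → EpsOrderLadder`: a violation of the ladder at budget `c`
(for every `n` a border width-2 S-affine program for `per_n` with `q, L ≤ 2^((log₂ n + c)^c)`)
is de-bordered by truncation and interpolation into `≤ L q + q + 1` exact width-2 S-affine
products over `ℂ[x]`, each of which is a word of length `≤ 2 · 8^((log₂ n + c)^c)` by the
Ben-Or–Cleve word algebra; summing gives words of quasi-polynomial length for `E₀₂(per_n)` for
every `n`, contradicting `X`. -/
theorem ladder_of_wordLengthQP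
    (hX : Summit.ValiantsHypothesis.ValiantsHypothesis.Theses.ElementaryWordLength.WordLengthQP) :
    ∀ c : ℕ, ∃ n : ℕ, ∀ q L : ℕ, q ≤ 2 ^ ((Nat.log 2 n + c) ^ c) →
      L ≤ 2 ^ ((Nat.log 2 n + c) ^ c) →
      ¬ (∃ ms : List (Matrix (Fin 2) (Fin 2) (MvPolynomial (Fin n × Fin n) (Polynomial ℂ))),
          ms.length ≤ L ∧
          (∀ m ∈ ms, ∀ i j : Fin 2, (∃ b : Polynomial ℂ, m i j = MvPolynomial.C b) ∨
            (∃ (a b : Polynomial ℂ) (v : Fin n × Fin n),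
              m i j = MvPolynomial.C a * MvPolynomial.X v + MvPolynomial.C b)) ∧
          ∃ G : MvPolynomial (Fin n × Fin n) (Polynomial ℂ),
            ms.prod 0 0 = MvPolynomial.C (Polynomial.X ^ q) *
                MvPolynomial.map Polynomial.C
                  (Literature.Computability.AlgebraicComplexity.perPoly (Fin n) ℂ) +
              MvPolynomial.C (Polynomial.X ^ (q + 1)) * G) := by
  intro c
  by_contra h
  push Not at h
  obtain ⟨c', hc'⟩ := stub_arith c
  apply hX
  refine ⟨c', fun n => ?_⟩
  obtain ⟨q, L, hq, hL, ms, hlen, hS, hF⟩ := h n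
  set E : ℕ := (Nat.log 2 n + c) ^ c with hE
  -- step 1: truncate the letters modulo `ε^(q+1)`
  obtain ⟨ms', hlen', hS', hF'⟩ := stub_truncate q _ ms hS hF
  -- step 2: moment weights for `D = L q + q`
  obtain ⟨x, cc, hxc⟩ := stub_interpNodes (L * q + q) q (Nat.le_add_left q (L * q))
  -- step 3: `per_n = Σᵢ ccᵢ • Fᵢ`, `Fᵢ` the `(0,0)` entry of the evaluated product
  have hper := stub_evalSum q L (L * q + q) _ ms' (hlen' ▸ hlen) (Nat.le_add_right _ _)
    (Nat.le_add_left _ _) hS' hF' x cc hxc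
  -- step 4: each evaluated product entry is a word of length `≤ 2 · 8^E`, its scalar multiple
  -- one of length `≤ 2 · 1 + 2 · (2 · 8^E)`
  have hword : ∀ i ∈ (Finset.univ : Finset (Fin (L * q + q + 1))),
      ∃ w : List (Fin 3 × Fin 3 × ℂ × Option (Fin n × Fin n)),
        w.length ≤ 2 * 1 + 2 * (2 * 8 ^ E) ∧ (∀ l ∈ w, l.1 ≠ l.2.1) ∧
        (w.map (fun l => Matrix.transvection l.1 l.2.1
          (MvPolynomial.C l.2.2.1 * l.2.2.2.elim 1 MvPolynomial.X))).prod =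
          Matrix.transvection (0 : Fin 3) 2 (cc i • (ms'.map (fun m =>
            (MvPolynomial.map (Polynomial.evalRingHom (x i))).mapMatrix m)).prod 0 0) := by
    intro i _
    rw [MvPolynomial.smul_eq_C_mul]
    refine hasWordAt_mul_all (fun p r hpr => hasWordAt_C hpr (cc i)) (fun p r hpr => ?_) 0 2
      (by decide)
    refine stub_prodWord E _ ?_ ?_ 0 0 p r hpr
    · rw [List.length_map, hlen']; exact hlen.trans hL
    · intro m hm
      obtain ⟨m₀, hm₀, rfl⟩ := List.mem_map.1 hm
      exact sAffine_eval (x i) q m₀ (hS' m₀ hm₀)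
  have hsum := hasWordAt_finset_sum (k := ℂ) (σ := Fin n × Fin n) (i := (0 : Fin 3)) (j := 2)
    (by decide) Finset.univ hword
  rw [← hper, Finset.card_univ, Fintype.card_fin] at hsum
  obtain ⟨w, hw, ho, hp⟩ := hsum
  refine ⟨w, hw.trans ?_, ho, hp⟩
  -- step 5: the bookkeeping `(L q + q + 1) (2 + 4 · 8^E) ≤ 2^((log₂ n + c')^c')`
  refine le_trans (Nat.mul_le_mul_right _ ?_) (hc' (Nat.log 2 n))
  exact Nat.add_le_add_right (Nat.add_le_add (Nat.mul_le_mul hL hq) hq) 1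

/-- **The open rung is crux-equivalent**: `EpsOrderLadder ↔ WordLengthQP` — the landed transfer
`stub_transfer` (Bringmann–Ikenmeyer–Zuiddam 2018 §3 at quasi-polynomial scale) one way, the
de-bordering `ladder_of_wordLengthQP` the other.  Consequently the remaining stub `stub_ladder`
of line `Sketch` is exactly as hard as the crux (the Extended Valiant Hypothesis in word form). -/
theorem ladder_iff_wordLengthQP :
    (∀ c : ℕ, ∃ n : ℕ, ∀ q L : ℕ, q ≤ 2 ^ ((Nat.log 2 n + c) ^ c) →
      L ≤ 2 ^ ((Nat.log 2 n + c) ^ c) →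
      ¬ (∃ ms : List (Matrix (Fin 2) (Fin 2) (MvPolynomial (Fin n × Fin n) (Polynomial ℂ))),
          ms.length ≤ L ∧
          (∀ m ∈ ms, ∀ i j : Fin 2, (∃ b : Polynomial ℂ, m i j = MvPolynomial.C b) ∨
            (∃ (a b : Polynomial ℂ) (v : Fin n × Fin n),
              m i j = MvPolynomial.C a * MvPolynomial.X v + MvPolynomial.C b)) ∧
          ∃ G : MvPolynomial (Fin n × Fin n) (Polynomial ℂ),
            ms.prod 0 0 = MvPolynomial.C (Polynomial.X ^ q) *
                MvPolynomial.map Polynomial.C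
                  (Literature.Computability.AlgebraicComplexity.perPoly (Fin n) ℂ) +
              MvPolynomial.C (Polynomial.X ^ (q + 1)) * G)) ↔
    Summit.ValiantsHypothesis.ValiantsHypothesis.Theses.ElementaryWordLength.WordLengthQP := by
  constructor
  · intro h
    unfold Summit.ValiantsHypothesis.ValiantsHypothesis.Theses.ElementaryWordLength.WordLengthQP
    exact stub_transfer h
  · exact ladder_of_wordLengthQP

end Summit.ValiantsHypothesis.ValiantsHypothesis.Cruxes.WordLengthQP.EpsOrderLadder
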